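import Literature.Probability.RandomPlanarGeometry.LoewnerImageDriverStep
import Literature.Probability.RandomPlanarGeometry.LoewnerImageStepFar
import HarnessLib

/-!
# One step of the conformal image of a Loewner chain, VII: the image flow of a point moves by the Loewner field `2 h_t'(W_t)² / (g̃_t(ζ) − W̃_t)`

Deterministic core of the locality of SLE₆ / of the LSW conjugation `h_t = g̃_t ∘ Φ_A ∘ g_t⁻¹`
(G. F. Lawler, O. Schramm, W. Werner, *Conformal restriction: the chordal case*, J. Amer. Math.
Soc. **16** (2003) (**[LSW]**), §5, (5.1) and the preceding paragraph: "`g̃_t := Φ_{K̃_t}` … the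
maps `g̃_t` satisfy the Loewner equation `∂_t g̃_t(z) = 2 h_t'(W_t)² / (g̃_t(z) − W̃_t)`, with
`W̃_t = h_t(W_t)`", i.e. the image `Φ_A(K_t)` is a Loewner chain run at speed `h_t'(W_t)²` with
driving value `W̃_t`; G. F. Lawler, *Conformally Invariant Processes in the Plane* (2005), §4.6.1,
Prop. 4.40–4.41 and (4.34)), in the one-step language of `LoewnerImageStep*`.

One step from the hull `B = B_s` (`*`-hull with restriction map `Φ`, `d = Φ'(0) = h_s'(W_s)`) under
the increment driver `U` run for time `u` (`B' = slidHull U B u`, restriction map `Φ'`): a point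
`y ∈ ℍ ∖ B` still flowing at time `u` (in the application `y = g_s(z) − W_s`) has old image
`w = h(y)` (`h = hmap Φ = E_B − L_B`) and new image `h'(g_u(y))` (`h' = hmapT Φ' (U u)`), where
`h' ∘ g_u = φ ∘ h` with `φ` the hydrodynamic map of the small image hull
(`phiStep_hmap_of_im_pos`, `isHydrodynamicAt_phiStep`). Its displacement

  `imageFlowStep := h'(g_u y) − h(y) = φ(w) − w`

is therefore governed by Lawler's small-hull expansion `φ(w) = w + a/(w − w₀) + O(a η/|w − w₀|²)`
(`IsHydrodynamicAt.norm_sub_sub_div_le`) about the image tip `w₀ = −L_B`, `w − w₀ = E_B(y)`, with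
capacity `a = stepCap ≈ 2 d² u` (`stepCap_le`, Lawler's (4.15) conjugated by `h`). We PROVE:

* `abs_stepCap_sub_le` (real form of `LoewnerImageStepFar.norm_stepCap_sub_le`), `stepCap_pos` —
  **`|a − 2d²u| ≤ u (1000 η/ρ₀ + 228 u/ρ₀²)`** and, under the smallness `η ≤ d²ρ₀/2000`,
  `a ≥ d²u > 0`;
* `map_sub_mem_diff_slidHull` — the flowed point `g_u(y) − U_u` lies in `ℍ ∖ B'`;
* `imageFlowStep_eq_phiStep_sub` — `h'(g_u y) − h(y) = φ(h y) − h y`;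
* `im_hmapT_map_le` — **the image flow lowers imaginary parts**: `Im h'(g_u y) ≤ Im h(y)`
  (boundary Julia lemma for `ψ = φ⁻¹`, `im_le_im_psiStep`; no smallness of `|E_B(y)|` needed) and
  `0 < Im h'(g_u y)`;
* **`norm_imageFlowStep_sub_field_le`** — for `|E_B(y)| ≥ 4η`:

    `‖(h'(g_u y) − h(y)) − 2 d² u / E_B(y)‖ ≤ u (1000 η/ρ₀ + 228 u/ρ₀²)/|E_B(y)| + 60 u η/|E_B(y)|²`,

  the one-step form of [LSW] (5.1) / Lawler (4.34) `∂_t g̃ = 2 h_t'(W_t)²/(g̃ − W̃)` (in slid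
  coordinates `g̃_t(ζ) − W̃_t = E_{B_t}(g_t z − W_t)`), with `norm_imageFlowStep_le` the crude
  displacement bound `≤ 20 u/|E_B(y)|`; together with `abs_imageDriverStep_le` this controls
  the increment of `E_{B_t}(g_t z − W_t)` along the flow (`norm_hullExt_map_sub_hullExt_le`).

Dividing by `u → 0⁺` along a continuous driving function gives the right derivative of the image
flow at every alive time (the sequel threads the cocycle `slidHull_add` and the local tube of
`RestrictionDerivTime`). No named fact, one definition (`imageFlowStep`).

## References

* [LSW] 2003, §5 (5.1) and the definition of `g̃_t`, `W̃_t`. [LawlerSchrammWerner2003Restriction]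
* G. F. Lawler (2005), §4.6.1 Prop. 4.40–4.41, (4.15), (4.34); Prop. 3.46. [Lawler2005]
-/

noncomputable section

open Set Filter Metric Bornology Function
open _root_.Complex _root_.Topology _root_.Real
open UpperHalfPlane (upperHalfPlaneSet isOpen_upperHalfPlaneSet)
open Literature.Analysis.Complex (IsHydrodynamicAt hcapAt)
open scoped ComplexConjugate NNReal

namespace Literature.Probability.RandomPlanarGeometry

namespace Loewner

variable {B : Set ℂ} {Φ : ConformalEquiv (upperHalfPlaneSet \ B) upperHalfPlaneSet} {d ρ₀ : ℝ}
  {U : ℝ≥0 → ℝ} {u : ℝ≥0} {S : ℝ}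
  {Φ' : ConformalEquiv (upperHalfPlaneSet \ slidHull U B u) upperHalfPlaneSet}
variable (hB : IsStarHull B) (hΦ : IsRestrictionMap B Φ) (hd : HasRestrictionDeriv B Φ d)
  (hU : Continuous U) (hU0 : U 0 = 0) (hu : 0 < u) (hS : ∀ v : ℝ≥0, v ≤ u → |U v| ≤ S)
  (hρ₀ : 0 < ρ₀) (hBρ : Disjoint (ball (0 : ℂ) (8 * ρ₀)) B)
  (hη : stepSize S u ≤ d * ρ₀ / 1000)
  (hΦ' : IsRestrictionMap (slidHull U B u) Φ')

/-! ### The displacement of the image of a flowing point -/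

/-- **The one-step displacement of the image flow at a point**: `h'(g_u(y)) − h(y)` with
`h = hmap Φ = E_B − L_B` the hydrodynamic map of the old hull and `h'(w) = E_{B'}(w − U_u) − L_{B'} + U_u`
that of the new one (`g̃_{s+u}(ζ) − g̃_s(ζ)` for `ζ = Φ_A(z)`, `y = g_s(z) − W_s`, in slid
coordinates). [cite: LawlerSchrammWerner2003Restriction, §5 (g̃_t, (5.1))] -/
def imageFlowStep (Φ : ConformalEquiv (upperHalfPlaneSet \ B) upperHalfPlaneSet)
    (Φ' : ConformalEquiv (upperHalfPlaneSet \ slidHull U B u) upperHalfPlaneSet) (y : ℂ) : ℂ :=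
  hmapT Φ' (U u) (map U u y) - hmap Φ y

include hB hΦ in
/-- `h(y) − w₀ = E_B(y)` (`w₀ = −L_B` the image tip; `L_B` is real). [folklore] -/
theorem hmap_sub_tip (y : ℂ) : hmap Φ y - ((-hullShift Φ).re : ℂ) = hullExt Φ y := by
  have hLreal : -hullShift Φ = (((-hullShift Φ).re : ℝ) : ℂ) :=
    Complex.ext rfl (by rw [ofReal_im, neg_im, hullShift_im hB.isBoundedHull hΦ, neg_zero])
  rw [← hLreal, hmap]; ring

include hB hU hu hS hBρ hη hd hΦ hρ₀ in
/-- **The flowed point lies in `ℍ ∖ B'`**: for `y ∈ ℍ ∖ B` still flowing at time `u`,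
`g_u(y) − U_u ∈ ℍ ∖ slidHull U B u` (the Loewner map preserves `ℍ` and is injective on the points
alive at time `u`, all of `B` being alive). [folklore] -/
theorem map_sub_mem_diff_slidHull {y : ℂ} (hy : y ∈ upperHalfPlaneSet \ B)
    (hyu : (u : WithTop ℝ≥0) < swallowingTime U y) :
    map U u y - U u ∈ upperHalfPlaneSet \ slidHull U B u := by
  obtain ⟨hd0, hd1, hη0, hη1, -⟩ := stepSize_small hB hΦ hd hu hS hρ₀ hη
  have hydom : y ∈ domain U u := (mem_domain_iff U u y).2 ⟨hy.1, hyu⟩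
  have hgy : map U u y ∈ upperHalfPlaneSet := mapsTo_map hU u hydom
  refine ⟨?_, ?_⟩
  · show 0 < (map U u y - U u).im
    rw [sub_im, ofReal_im, sub_zero]; exact hgy
  · rintro ⟨b, hb, hbe⟩
    have hbalive := (alive_of_mem hU hu hS hBρ (hη.trans (by nlinarith)) hb).1
    have heq : map U u b = map U u y := by
      have := congrArg (· + (U u : ℂ)) hbe
      simpa using this
    -- `b` is real or in `ℍ`; if `b ∈ ℍ`, injectivity on the domain gives `b = y ∈ B`
    have hbim : 0 ≤ b.im := by
      have := hB.isBoundedHull.subset_closure hb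
      rwa [show upperHalfPlaneSet = {z : ℂ | 0 < z.im} from rfl, Complex.closure_setOf_lt_im] at this
    rcases hbim.lt_or_eq with hbpos | hbzero
    · have hbdom : b ∈ domain U u := (mem_domain_iff U u b).2 ⟨hbpos, hbalive⟩
      have := injOn_map hU u hbdom hydom heq
      exact hy.2 (this ▸ hb)
    · -- a real alive point stays real, but `map U u y ∈ ℍ`
      have hb' : b = (((b.re : ℝ)) : ℂ) := Complex.ext rfl (by rw [ofReal_im]; exact hbzero.symm)
      rw [hb'] at hbalive heq
      have hreal : (map U u (b.re : ℝ)).im = 0 := map_ofReal_im hU hbalive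
      rw [heq] at hreal
      exact absurd hreal (ne_of_gt hgy)

include hB hΦ in
/-- **`h'(g_u y) − h(y) = φ(h y) − h y`** (`φ = phiStep Φ Φ' r`, any radius `r`: on `ℍ` the
reflected map is `h' ∘ g_u ∘ h⁻¹`). [cite: Lawler2005, §4.6.1 (Φ_t ∘ g_{s,t} = g*_{s,t} ∘ Φ_s)] -/
theorem imageFlowStep_eq_phiStep_sub {y : ℂ} (hy : y ∈ upperHalfPlaneSet \ B) (r : ℝ) :
    imageFlowStep Φ Φ' y = phiStep Φ Φ' r (hmap Φ y) - hmap Φ y := by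
  rw [imageFlowStep, phiStep_hmap_of_im_pos hB hΦ hy r]

/-! ### The image flow lowers imaginary parts -/

include hB hΦ hd hU hU0 hu hS hρ₀ hBρ hη hΦ' in
/-- **`0 < Im h'(g_u y) ≤ Im h(y)`**: the image flow keeps points in `ℍ` and lowers their imaginary
parts (`ψ(h'(g_u y)) = h(y)` for the inverse map `ψ = h ∘ g_u⁻¹ ∘ h'⁻¹ : ℍ → ℍ`, which raises
imaginary parts by the boundary Julia lemma, `im_le_im_psiStep`). In the application: `t ↦ Im g̃_t(ζ)`
is non-increasing. [cite: Lawler2005, §4.6.1 with Prop. 3.36 (Im g_A ≤ Im)] -/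
theorem im_hmapT_map_le {y : ℂ} (hy : y ∈ upperHalfPlaneSet \ B)
    (hyu : (u : WithTop ℝ≥0) < swallowingTime U y) :
    0 < (hmapT Φ' (U u) (map U u y)).im ∧ (hmapT Φ' (U u) (map U u y)).im ≤ (hmap Φ y).im := by
  obtain ⟨hd0, hd1, hη0, hη1, -⟩ := stepSize_small hB hΦ hd hu hS hρ₀ hη
  have hηρ : stepSize S u ≤ ρ₀ := by linarith
  have hB' := isStarHull_slidHull_step hB hU hU0 hS hρ₀ hBρ hηρ
  have hgy := map_sub_mem_diff_slidHull hB hΦ hd hU hu hS hρ₀ hBρ hη hy hyu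
  set ζ : ℂ := hmapT Φ' (U u) (map U u y) with hζdef
  have hζim : 0 < ζ.im := by
    rw [hζdef, hmapT, add_im, sub_im, ofReal_im, hullShift_im hB'.isBoundedHull hΦ', sub_zero, add_zero]
    exact hullExt_im_pos hgy
  refine ⟨hζim, ?_⟩
  -- `ψ(ζ) = h(y)`
  have hydom : y ∈ domain U u := (mem_domain_iff U u y).2 ⟨hy.1, hyu⟩
  have hψ : psiStep Φ Φ' ζ = hmap Φ y := by
    rw [psiStep]
    have h1 : ζ - U u + hullShift Φ' = Φ' (map U u y - U u) := by
      rw [hζdef, hmapT, hullExt_of_mem_diff hgy]; ring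
    rw [h1, Φ'.symm_apply_apply hgy, sub_add_cancel, loewnerInv_map hU hydom]
  have := im_le_im_psiStep hB hΦ hU hU0 hS hρ₀ hBρ hηρ hΦ' hζim
  rwa [hψ] at this

/-! ### The capacity of the step: `a = 2 d² u + O(u(η + u))`, `a > 0` -/

include hB hΦ hd hU hU0 hu hS hρ₀ hBρ hη hΦ' in
/-- **`|a − 2 d² u| ≤ u (1000 η/ρ₀ + 228 u/ρ₀²)`**, real form of `norm_stepCap_sub_le`
(`LoewnerImageStepFar`; Lawler's (4.15) conjugated by `h`). [cite: Lawler2005, §4.6.1 proof of Prop. 4.40 with (4.15)] -/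
theorem abs_stepCap_sub_le :
    |stepCap Φ Φ' (2 * stepSize S u) - 2 * d ^ 2 * u| ≤ u * (1000 * stepSize S u / ρ₀ + 228 * u / ρ₀ ^ 2) := by
  have h := norm_stepCap_sub_le hB hΦ hd hU hU0 hu hS hρ₀ hBρ hη hΦ'
  have hid : ((stepCap Φ Φ' (2 * stepSize S u) : ℝ) : ℂ) - 2 * (u : ℂ) * d ^ 2 =
      ((stepCap Φ Φ' (2 * stepSize S u) - 2 * d ^ 2 * u : ℝ) : ℂ) := by push_cast; ring
  rwa [hid, norm_real, Real.norm_eq_abs] at h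

include hB hΦ hd hU hU0 hu hS hρ₀ hBρ hη hΦ' in
/-- **`a ≥ d² u > 0` under the smallness `η ≤ d²ρ₀/2000`** (then `1000η/ρ₀ ≤ d²/2` and
`228u/ρ₀² ≤ d²/2`, as `u ≤ η²/16`). [folklore] -/
theorem stepCap_pos (hη2 : stepSize S u ≤ d ^ 2 * ρ₀ / 2000) :
    (d : ℝ) ^ 2 * u ≤ stepCap Φ Φ' (2 * stepSize S u) ∧ 0 < stepCap Φ Φ' (2 * stepSize S u) := by
  obtain ⟨hd0, hd1, hη0, hη1, huη, -⟩ := stepSize_small hB hΦ hd hu hS hρ₀ hη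
  have h := abs_stepCap_sub_le hB hΦ hd hU hU0 hu hS hρ₀ hBρ hη hΦ'
  have hu0 : (0 : ℝ) < u := hu
  have h1 : 1000 * stepSize S u / ρ₀ ≤ d ^ 2 / 2 := by
    rw [div_le_div_iff₀ hρ₀ (by norm_num)]; nlinarith
  have h2 : 228 * (u : ℝ) / ρ₀ ^ 2 ≤ d ^ 2 / 2 := by
    rw [div_le_div_iff₀ (by positivity) (by norm_num)]
    have hη2' : stepSize S u ^ 2 ≤ (d ^ 2 * ρ₀ / 2000) ^ 2 := pow_le_pow_left₀ hη0.le hη2 2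
    have hd4 : d ^ 4 ≤ d ^ 2 := by nlinarith [mul_le_one₀ hd1 hd0.le hd1]
    nlinarith [huη, hη2', hd4, pow_pos hρ₀ 2]
  have h3 : (u : ℝ) * (1000 * stepSize S u / ρ₀ + 228 * u / ρ₀ ^ 2) ≤ u * d ^ 2 :=
    mul_le_mul_of_nonneg_left (by linarith) hu0.le
  have h4 := (abs_le.1 (h.trans h3)).1
  constructor
  · nlinarith
  · have : 0 < d ^ 2 * (u : ℝ) := by positivity
    nlinarith

/-! ### The expansion of the displacement -/

include hB hΦ hd hU hU0 hu hS hρ₀ hBρ hη hΦ' in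
/-- **The crude displacement bound `‖h'(g_u y) − h(y)‖ ≤ 20 u/|E_B(y)|`** for `|E_B(y)| ≥ 4η`
(`|φ(w) − w| ≤ 4a/|w − w₀|`, `a ≤ 5 d u ≤ 5u`): along the flow `t ↦ g̃_t(ζ)` is continuous.
[cite: Lawler2005, Prop. 3.46] -/
theorem norm_imageFlowStep_le (hη2 : stepSize S u ≤ d ^ 2 * ρ₀ / 2000) {y : ℂ}
    (hy : y ∈ upperHalfPlaneSet \ B) (hEy : 4 * stepSize S u ≤ ‖hullExt Φ y‖) :
    ‖imageFlowStep Φ Φ' y‖ ≤ 20 * u / ‖hullExt Φ y‖ := by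
  obtain ⟨hd0, hd1, hη0, hη1, -⟩ := stepSize_small hB hΦ hd hu hS hρ₀ hη
  have hηρ : stepSize S u ≤ ρ₀ := by linarith
  have hH := isHydrodynamicAt_phiStep hB hΦ hU hU0 hu hS hρ₀ hBρ hηρ hΦ'
  obtain ⟨ha5, -⟩ := stepCap_le hB hΦ hd hU hU0 hu hS hρ₀ hBρ hη hΦ'
  obtain ⟨-, hapos⟩ := stepCap_pos hB hΦ hd hU hU0 hu hS hρ₀ hBρ hη hΦ' hη2
  rw [imageFlowStep_eq_phiStep_sub hB hΦ hy (2 * stepSize S u)]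
  have hw : 2 * (2 * stepSize S u) ≤ ‖hmap Φ y - ((-hullShift Φ).re : ℂ)‖ := by
    rw [hmap_sub_tip hB hΦ]; linarith
  have h1 := hH.norm_sub_self_le hapos hw
  rw [hmap_sub_tip hB hΦ] at h1
  have hE0 : 0 < ‖hullExt Φ y‖ := by linarith
  refine h1.trans ?_
  rw [show stepCap Φ Φ' (2 * stepSize S u) = hcapAt (phiStep Φ Φ' (2 * stepSize S u)) ((-hullShift Φ).re) from rfl] at ha5
  rw [div_le_div_iff_of_pos_right hE0]
  have : 5 * d * (u : ℝ) ≤ 5 * u := by nlinarith [u.coe_nonneg]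
  linarith

include hB hΦ hd hU hU0 hu hS hρ₀ hBρ hη hΦ' in
/-- **The image flow moves by the Loewner field, one step** ([LSW] (5.1) / Lawler (4.34),
quantitative): for `y ∈ ℍ ∖ B` with `|E_B(y)| ≥ 4η` and `η ≤ d²ρ₀/2000`,

  `‖(h'(g_u y) − h(y)) − 2 d² u / E_B(y)‖ ≤ u (1000 η/ρ₀ + 228 u/ρ₀²)/|E_B(y)| + 60 u η/|E_B(y)|²`

(`φ(w) − w = a/(w − w₀) + O(6 a · 2η/|w − w₀|²)` with `w − w₀ = E_B(y)`, `|a − 2d²u| = O(u(η + u))`,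
`a ≤ 5u`). Divided by `u → 0⁺`: `∂_t⁺ g̃_t(ζ) = 2 h_t'(W_t)²/(g̃_t(ζ) − W̃_t)`.
[cite: LawlerSchrammWerner2003Restriction, §5 (5.1); Lawler2005, (4.34)] -/
theorem norm_imageFlowStep_sub_field_le (hη2 : stepSize S u ≤ d ^ 2 * ρ₀ / 2000) {y : ℂ}
    (hy : y ∈ upperHalfPlaneSet \ B) (hEy : 4 * stepSize S u ≤ ‖hullExt Φ y‖) :
    ‖imageFlowStep Φ Φ' y - 2 * (d : ℂ) ^ 2 * u / hullExt Φ y‖ ≤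
      u * (1000 * stepSize S u / ρ₀ + 228 * u / ρ₀ ^ 2) / ‖hullExt Φ y‖ +
        60 * u * stepSize S u / ‖hullExt Φ y‖ ^ 2 := by
  obtain ⟨hd0, hd1, hη0, hη1, -⟩ := stepSize_small hB hΦ hd hu hS hρ₀ hη
  have hηρ : stepSize S u ≤ ρ₀ := by linarith
  have hH := isHydrodynamicAt_phiStep hB hΦ hU hU0 hu hS hρ₀ hBρ hηρ hΦ'
  obtain ⟨ha5, -⟩ := stepCap_le hB hΦ hd hU hU0 hu hS hρ₀ hBρ hη hΦ'
  obtain ⟨-, hapos⟩ := stepCap_pos hB hΦ hd hU hU0 hu hS hρ₀ hBρ hη hΦ' hη2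
  have hcap := abs_stepCap_sub_le hB hΦ hd hU hU0 hu hS hρ₀ hBρ hη hΦ'
  set a : ℝ := stepCap Φ Φ' (2 * stepSize S u) with ha
  set E : ℂ := hullExt Φ y with hEdef
  have hE0 : 0 < ‖E‖ := by linarith
  have hEne : E ≠ 0 := norm_pos_iff.1 hE0
  rw [imageFlowStep_eq_phiStep_sub hB hΦ hy (2 * stepSize S u)]
  have hw : 2 * (2 * stepSize S u) ≤ ‖hmap Φ y - ((-hullShift Φ).re : ℂ)‖ := by
    rw [hmap_sub_tip hB hΦ]; linarith
  have h1 := hH.norm_sub_sub_div_le hapos hw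
  rw [hmap_sub_tip hB hΦ] at h1
  have ha' : hcapAt (phiStep Φ Φ' (2 * stepSize S u)) ((-hullShift Φ).re) = a := rfl
  rw [ha'] at h1
  -- split off the capacity error `(a − 2d²u)/E`
  have hid : phiStep Φ Φ' (2 * stepSize S u) (hmap Φ y) - hmap Φ y - 2 * (d : ℂ) ^ 2 * u / E =
      (phiStep Φ Φ' (2 * stepSize S u) (hmap Φ y) - hmap Φ y - (a : ℂ) / E) + ((a - 2 * d ^ 2 * u : ℝ) : ℂ) / E := by
    push_cast; field_simp; ring
  rw [hid]
  refine (norm_add_le _ _).trans (add_le_add (h1.trans ?_) ?_) |>.trans (le_of_eq (add_comm _ _))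
  · -- `6 a (2η)/|E|² ≤ 60 u η/|E|²` from `a ≤ 5u`
    have ha5' : a ≤ 5 * u := ha5.trans (by nlinarith [u.coe_nonneg])
    rw [div_le_div_iff_of_pos_right (by positivity)]
    nlinarith [hη0.le]
  · rw [norm_div, norm_real, Real.norm_eq_abs]
    exact div_le_div_of_nonneg_right hcap hE0.le

include hB hΦ hd hU hU0 hu hS hρ₀ hBρ hη hΦ' in
/-- **The increment of `E_B(y)` along the flow**: `E_{B'}(g_u y − U_u) − E_B(y)` is the displacement
of the image flow minus the increment `ΔW̃ = U_u + L_B − L_{B'}` of the image driving value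
(`imageDriverStep` of `LoewnerImageDriverStep`, canonical data), so for `|E_B(y)| ≥ 4η`,
`η ≤ d²ρ₀/2000`: `‖E_{B'}(g_u y − U_u) − E_B(y)‖ ≤ 20u/|E_B(y)| + 25u/ρ₀ + 2|U_u|` — along the
flow `t ↦ g̃_t(ζ) − W̃_t = E_{B_t}(g_t z − W_t)` is continuous. [folklore] -/
theorem norm_hullExt_map_sub_hullExt_le (hη2 : stepSize S u ≤ d ^ 2 * ρ₀ / 2000) {y : ℂ}
    (hy : y ∈ upperHalfPlaneSet \ B) (hEy : 4 * stepSize S u ≤ ‖hullExt Φ y‖)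
    (hΦc : Φ = starRMap B hB) (hΦ'c : Φ' = starRMap (slidHull U B u)
      (isStarHull_slidHull_step hB hU hU0 hS hρ₀ hBρ
        ((stepSize_small hB hΦ hd hu hS hρ₀ hη).2.2.2.1.trans (by linarith [hρ₀])))) :
    ‖hullExt Φ' (map U u y - U u) - hullExt Φ y‖ ≤ 20 * u / ‖hullExt Φ y‖ + 25 * u / ρ₀ + 2 * |U u| := by
  obtain ⟨hd0, hd1, hη0, hη1, -⟩ := stepSize_small hB hΦ hd hu hS hρ₀ hη
  have hηρ : stepSize S u ≤ ρ₀ := by linarith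
  have hB' := isStarHull_slidHull_step hB hU hU0 hS hρ₀ hBρ hηρ
  have hdd : d = starDeriv B := HasRestrictionDeriv.eq_starDeriv hB hΦ (hΦc ▸ hd) |>.trans rfl
  have hηc : stepSize S u ≤ starDeriv B * ρ₀ / 1000 := hdd ▸ hη
  have hflow := norm_imageFlowStep_le hB hΦ hd hU hU0 hu hS hρ₀ hBρ hη hΦ' hη2 hy hEy
  have hdrv := abs_imageDriverStep_le hB hU hU0 hu hS hρ₀ hBρ hηc
  -- the identity `E'(g y − U u) − E y = imageFlowStep − imageDriverStep`
  have hid : hullExt Φ' (map U u y - U u) - hullExt Φ y = imageFlowStep Φ Φ' y - (imageDriverStep B U u : ℂ) := by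
    rw [imageFlowStep, hmapT, hmap, imageDriverStep]
    push_cast
    rw [← starShift_eq_ofReal_re hB, ← starShift_eq_ofReal_re hB', starShift_eq hB, starShift_eq hB', ← hΦc,
      ← hΦ'c]
    ring
  rw [hid]
  calc ‖imageFlowStep Φ Φ' y - (imageDriverStep B U u : ℂ)‖ ≤ ‖imageFlowStep Φ Φ' y‖ + ‖(imageDriverStep B U u : ℂ)‖ :=
        norm_sub_le _ _
    _ ≤ 20 * u / ‖hullExt Φ y‖ + (25 * u / ρ₀ + 2 * |U u|) := by
        rw [norm_real, Real.norm_eq_abs]; exact add_le_add hflow hdrv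
    _ = _ := by ring

include hB hΦ hd hU hU0 hu hS hρ₀ hBρ hη hΦ' in
/-- **Uniform form of (5.1) one step**: when `‖E_B(y)‖ ≥ 4η`, the image point moves by at most
`5u/η` (`20u/‖E_B(y)‖ ≤ 20u/(4η)`). [folklore] -/
theorem norm_imageFlowStep_le_div_stepSize (hη2 : stepSize S u ≤ d ^ 2 * ρ₀ / 2000) {y : ℂ}
    (hy : y ∈ upperHalfPlaneSet \ B) (hEy : 4 * stepSize S u ≤ ‖hullExt Φ y‖) :
    ‖imageFlowStep Φ Φ' y‖ ≤ 5 * u / stepSize S u := by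
  obtain ⟨-, -, hη0, -, -⟩ := stepSize_small hB hΦ hd hu hS hρ₀ hη
  have h := norm_imageFlowStep_le hB hΦ hd hU hU0 hu hS hρ₀ hBρ hη hΦ' hη2 hy hEy
  have hE0 : 0 < ‖hullExt Φ y‖ := lt_of_lt_of_le (by positivity) hEy
  refine h.trans ?_
  rw [div_le_div_iff₀ hE0 hη0]
  have hu0 : (0 : ℝ) ≤ u := u.coe_nonneg
  nlinarith

end Loewner

end Literature.Probability.RandomPlanarGeometry

end
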